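import Summits.CriticalPhenomena.PercolationContinuityZ3.Theorems.PercNearOneGluingNoHeavyPcintNawFreeZ4F12Defs
import HarnessLib

/-!
# PCINT lane, kernel reduced-state B2d (`nawfree`) certificate `Z4F12` (d = 4, memory τ = 12, delay kt = 4, 12932 state classes): row checks 13 (rows [3600, 3900))

Cell `prim-pcint`, seat `prim-pcint-1` (gen 7); memo `run/shared/lean/prim/pcint/REDUCTIONS.md` §B2d (delayed chain payments with
free-neighbour shares).  Does NOT build on p205010.  Data for `NawK.le_siteCriticalProb_of_checkRowsF` (`…PcintNawFreeMemKernelCert`):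
`p = 17090/100000`, weight table `Q_k/100000`, `Q = [82910, 82910, 91055, 93944, 95423, 96322, 96925, 97359, 97685]` (`Q_k^k·100000 ≥ (100000-17090)·100000^k`, nondecreasing), `λ = 99999/100000`; Collatz–Wielandt
weights (scale 10⁹) from a power iteration, exact off-line max row ratio 0.9994858418 < λ.  Generated by work/gen6/gen_free.py
(pcint-1 gen 6; run by gen 7); the kernel re-checks every row.
-/

namespace Summit.CriticalPhenomena.PercolationContinuityZ3.Theorems.Pcint.NawFreeZ4F12

set_option maxHeartbeats 0 in
/-- Rows `[3600, 3650)` pass the check. [folklore] -/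
theorem chk_3600 : WinK.allRange (NawK.checkRowF 12 4 4 12932 17090 100000 99999 100000 NawFreeZ4F12.QL NawFreeZ4F12.syms NawFreeZ4F12.tree) 3600 3650 = true :=
  WinK.allRange_of_allRangeB (fuel := 8) (lo := 3600) (len := 50) (by decide +kernel)

set_option maxHeartbeats 0 in
/-- Rows `[3650, 3700)` pass the check. [folklore] -/
theorem chk_3650 : WinK.allRange (NawK.checkRowF 12 4 4 12932 17090 100000 99999 100000 NawFreeZ4F12.QL NawFreeZ4F12.syms NawFreeZ4F12.tree) 3650 3700 = true :=
  WinK.allRange_of_allRangeB (fuel := 8) (lo := 3650) (len := 50) (by decide +kernel)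

set_option maxHeartbeats 0 in
/-- Rows `[3700, 3750)` pass the check. [folklore] -/
theorem chk_3700 : WinK.allRange (NawK.checkRowF 12 4 4 12932 17090 100000 99999 100000 NawFreeZ4F12.QL NawFreeZ4F12.syms NawFreeZ4F12.tree) 3700 3750 = true :=
  WinK.allRange_of_allRangeB (fuel := 8) (lo := 3700) (len := 50) (by decide +kernel)

set_option maxHeartbeats 0 in
/-- Rows `[3750, 3800)` pass the check. [folklore] -/
theorem chk_3750 : WinK.allRange (NawK.checkRowF 12 4 4 12932 17090 100000 99999 100000 NawFreeZ4F12.QL NawFreeZ4F12.syms NawFreeZ4F12.tree) 3750 3800 = true :=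
  WinK.allRange_of_allRangeB (fuel := 8) (lo := 3750) (len := 50) (by decide +kernel)

set_option maxHeartbeats 0 in
/-- Rows `[3800, 3850)` pass the check. [folklore] -/
theorem chk_3800 : WinK.allRange (NawK.checkRowF 12 4 4 12932 17090 100000 99999 100000 NawFreeZ4F12.QL NawFreeZ4F12.syms NawFreeZ4F12.tree) 3800 3850 = true :=
  WinK.allRange_of_allRangeB (fuel := 8) (lo := 3800) (len := 50) (by decide +kernel)

set_option maxHeartbeats 0 in
/-- Rows `[3850, 3900)` pass the check. [folklore] -/
theorem chk_3850 : WinK.allRange (NawK.checkRowF 12 4 4 12932 17090 100000 99999 100000 NawFreeZ4F12.QL NawFreeZ4F12.syms NawFreeZ4F12.tree) 3850 3900 = true :=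
  WinK.allRange_of_allRangeB (fuel := 8) (lo := 3850) (len := 50) (by decide +kernel)

/-- Rows `[3600, 3900)` pass the check. [folklore] -/
theorem file_13 : WinK.allRange (NawK.checkRowF 12 4 4 12932 17090 100000 99999 100000 NawFreeZ4F12.QL NawFreeZ4F12.syms NawFreeZ4F12.tree) 3600 3900 = true := (WinK.allRange_split (WinK.allRange_split (WinK.allRange_split (WinK.allRange_split (WinK.allRange_split chk_3600 chk_3650) chk_3700) chk_3750) chk_3800) chk_3850)

end Summit.CriticalPhenomena.PercolationContinuityZ3.Theorems.Pcint.NawFreeZ4F12
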